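import Summits.ValiantsHypothesis.ValiantsHypothesis.Theorems.KPlusLogSqLawTropicalBHalfThinUnsigned

/-!
# Route «KPlusLogSqLaw», crux `TropicalB` (stmt-ValiantsHypothesis-19771) — the THREE-WEIGHTED half-thin law:
# `3·(n+1) ≤ (3 + m(K−1))·|Π| + 2m²(K−1) + D`, `D` = the number of DOUBLE steps; for `m = 3`: «twelve per class level plus a third of the doubles»

HONEST FRAMING.  Helper toward the crux `Summit.ValiantsHypothesis.ValiantsHypothesis.Theses.KPlusLogSqLaw.TropicalB` (ledger item
`stmt-ValiantsHypothesis-19771`, registered stubs `stub_tropThin` / `stub_tropFat`; cell `pub-symmetroid`, seat val-sym-trop-p3 g17, 2026-08-29;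
`--supports … --as helper`).  A sign-free STRUCTURE inequality about one dominant chain of an ARBITRARY design (super-fat-corner bookkeeping, the
`m = 3` ceiling programme of the lineage); it bounds nothing by itself beyond the half-thin law and bears on neither `TropicalB` in its window nor
`WeakLifting`, the doors, `MatrixDescartes` (stmt-ValiantsHypothesis-18050) or VP ≠ VNP.

THE LAW (`three_mul_succ_le_of_succ_ne`).  For a dominant chain `p₀, …, pₙ` with consecutive terms distinct (unsigned currency), let `Π` be the set of
permutations used, a STEP a pair of consecutive uses `i < k` of one permutation, and `D` the number of steps whose class vectors differ at EXACTLY TWO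
columns («double steps»).  Then

  `3·(n+1) ≤ (3 + m(K−1))·|Π| + 2·m²(K−1) + D`.

Proof = val-sym-trop-p4 g4's half-thin bookkeeping (`…TropicalBHalfThin`, unsigned form `…HalfThinUnsigned`) with the step weight `2 ≤ [tight] + r`
replaced by `3 ≤ 2·[tight] + [double] + r` (`r` = number of changed columns): tight steps `≤ m²(K−1)` (refresh exclusivity, `card_tight_le`), change
mass `≤ (K−1)·|Π|·m` (`sum_card_chg_le`), first uses `≤ |Π|`.  For `m = 3` (`|Π| ≤ 6`) it reads `n + 1 ≤ 6 + 12(K−1) + D/3`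
(`three_row_twelve_add_doubles`): the `m = 3` tropical row exceeds TWELVE terms per class level only through double steps (the half-thin ceiling
`13.5` per level is the case `D = 4.5(K−1)`; the realised eleven-per-level family `ThreeRowElevenFamily` has, per level, 6 tight + 3 double + 2 triple
steps).  READING for the ceiling programme (memo HOME/val-sym-trop-p3/g17/M34-ROWS-g17.md §8): every advance event is a FIRST ENTRY of a (cell, class)
pair or a CATCH-UP of the partner permutation's earlier entry; `3·#steps = 2·#tight + #double + #first-entries + #catch-ups` exactly, and the double
steps that the `12 per level` conjecture must pay for are the (catch-up, catch-up) ones, whose two partner first entries lie strictly inside the step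
(bracketing, `…TropicalBTightBracketing`) and starve its fixed column (`…TropicalBTightBracketingThree`).
[this cell; the counting frame is val-sym-trop-p4 g4's]
-/

set_option linter.dupNamespace false
set_option autoImplicit false

namespace Summit.ValiantsHypothesis.ValiantsHypothesis.Theorems.KPlusLogSqLaw

open Summit.ValiantsHypothesis.ValiantsHypothesis.Theorems.MatrixDescartes.Negative
open Summit.ValiantsHypothesis.ValiantsHypothesis.Theorems.LacunarySymmetroidMatrixDescartes.TropicalCensus
open Finset

namespace RefreshExclusivity

section Chain

variable {m K n : ℕ} (d : Fin K → ℕ) (v ε : Fin m → Fin m → Fin K → ℤ) (θ : Fin (n + 1) → ℤ)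
  (p : Fin (n + 1) → Equiv.Perm (Fin m) × (Fin m → Fin K))

/-- **THREE-WEIGHTED HALF-THIN LAW (unsigned).**  A dominant chain of `n + 1` terms with consecutive terms distinct, using the set `Π` of
permutations and having `D` double steps (steps of one permutation changing the class at exactly two columns), satisfies
`3(n+1) ≤ (3 + m(K−1))·|Π| + 2m²(K−1) + D`. [this cell] -/
theorem three_mul_succ_le_of_succ_ne (hθ : StrictMono θ) (hdom : ∀ k, IsDominant d v ε (θ k) (p k))
    (hsucc : ∀ k : Fin n, p k.castSucc ≠ p k.succ) :
    3 * (n + 1) ≤ (3 + m * (K - 1)) * (univ.image fun k => (p k).1).card + 2 * (m ^ 2 * (K - 1)) +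
      ((univ : Finset (Fin (n + 1) × Fin (n + 1))).filter fun ik =>
        (ik.1 < ik.2 ∧ (p ik.1).1 = (p ik.2).1 ∧ ∀ j, ik.1 < j → j < ik.2 → (p j).1 ≠ (p ik.2).1) ∧
        (univ.filter fun b => (p ik.1).2 b ≠ (p ik.2).2 b).card = 2).card := by
  classical
  -- steps: consecutive uses of a permutation
  set St : Finset (Fin (n + 1) × Fin (n + 1)) := univ.filter fun ik =>
      ik.1 < ik.2 ∧ (p ik.1).1 = (p ik.2).1 ∧ ∀ j, ik.1 < j → j < ik.2 → (p j).1 ≠ (p ik.2).1 with hSt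
  have hStmem : ∀ ik, ik ∈ St ↔
      ik.1 < ik.2 ∧ (p ik.1).1 = (p ik.2).1 ∧ ∀ j, ik.1 < j → j < ik.2 → (p j).1 ≠ (p ik.2).1 := by
    intro ik
    rw [hSt, Finset.mem_filter]
    exact ⟨fun h => h.2, fun h => ⟨mem_univ _, h⟩⟩
  -- the double steps are the steps with exactly two changed columns
  have hDeq : ((univ : Finset (Fin (n + 1) × Fin (n + 1))).filter fun ik =>
        (ik.1 < ik.2 ∧ (p ik.1).1 = (p ik.2).1 ∧ ∀ j, ik.1 < j → j < ik.2 → (p j).1 ≠ (p ik.2).1) ∧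
        (univ.filter fun b => (p ik.1).2 b ≠ (p ik.2).2 b).card = 2) =
      St.filter fun ik => (univ.filter fun b => (p ik.1).2 b ≠ (p ik.2).2 b).card = 2 := by
    rw [hSt, Finset.filter_filter]
  rw [hDeq]
  -- first uses
  set NP : Finset (Fin (n + 1)) := univ.filter fun k => ∀ i, i < k → (p i).1 ≠ (p k).1 with hNP
  have hNPmem : ∀ k, k ∈ NP ↔ ∀ i, i < k → (p i).1 ≠ (p k).1 := by
    intro k
    rw [hNP, Finset.mem_filter]
    exact ⟨fun h => h.2, fun h => ⟨mem_univ _, h⟩⟩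
  -- (1) every position is a first use or the later endpoint of a step
  have h1 : ∀ k : Fin (n + 1), k ∈ NP ∨ ∃ i, (i, k) ∈ St := by
    intro k
    by_cases h : ∃ i, i < k ∧ (p i).1 = (p k).1
    · right
      obtain ⟨i₀, hi₀⟩ := h
      set S : Finset (Fin (n + 1)) := univ.filter fun i => i < k ∧ (p i).1 = (p k).1 with hS
      have hSmem : ∀ i, i ∈ S ↔ i < k ∧ (p i).1 = (p k).1 := by
        intro i
        rw [hS, Finset.mem_filter]
        exact ⟨fun h => h.2, fun h => ⟨mem_univ _, h⟩⟩
      have hSne : S.Nonempty := ⟨i₀, (hSmem i₀).2 hi₀⟩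
      obtain ⟨hlt, hperm⟩ := (hSmem _).1 (S.max'_mem hSne)
      refine ⟨S.max' hSne, (hStmem _).2 ⟨hlt, hperm, fun j hj hjk heq => ?_⟩⟩
      exact absurd (S.le_max' j ((hSmem j).2 ⟨hjk, heq⟩)) (not_le.mpr hj)
    · left
      push Not at h
      exact (hNPmem k).2 h
  -- (2) `n + 1 ≤ |NP| + |St|`
  have h2 : n + 1 ≤ NP.card + St.card := by
    have hsub : (univ : Finset (Fin (n + 1))) ⊆ NP ∪ St.image Prod.snd := by
      intro k _
      rcases h1 k with h | ⟨i, hi⟩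
      · exact Finset.mem_union_left _ h
      · exact Finset.mem_union_right _ (Finset.mem_image.mpr ⟨(i, k), hi, rfl⟩)
    calc n + 1 = (univ : Finset (Fin (n + 1))).card := by rw [Finset.card_univ, Fintype.card_fin]
      _ ≤ (NP ∪ St.image Prod.snd).card := Finset.card_le_card hsub
      _ ≤ NP.card + (St.image Prod.snd).card := Finset.card_union_le _ _
      _ ≤ NP.card + St.card := Nat.add_le_add_left Finset.card_image_le _
  -- (3) first uses are at most the distinct permutations
  have h3 : NP.card ≤ (univ.image fun k => (p k).1).card := by
    refine Finset.card_le_card_of_injOn (fun k => (p k).1)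
      (fun k _ => Finset.mem_image.mpr ⟨k, mem_univ _, rfl⟩) ?_
    intro k hk k' hk' hkk'
    by_contra hne
    rcases lt_or_gt_of_ne hne with h | h
    · exact (hNPmem k').1 hk' k h hkk'
    · exact (hNPmem k).1 hk k' h (Eq.symm hkk')
  -- (4) a step changes at least one column
  have h4 : ∀ ik ∈ St, 1 ≤ (univ.filter fun b => (p ik.1).2 b ≠ (p ik.2).2 b).card := by
    intro ik hik
    obtain ⟨hlt, hperm, -⟩ := (hStmem ik).1 hik
    rw [Nat.one_le_iff_ne_zero, Ne, Finset.card_eq_zero, Finset.filter_eq_empty_iff]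
    intro hall
    apply chain_ne_of_succ_ne d v ε θ p hθ hdom hsucc hlt
    exact Prod.ext hperm (funext fun b => by
      by_contra hb
      exact hall (mem_univ b) hb)
  -- (5) `3·#steps ≤ 2·#tight + #double + change mass`
  have h5 : 3 * St.card ≤
      2 * (St.filter fun ik => (univ.filter fun b => (p ik.1).2 b ≠ (p ik.2).2 b).card = 1).card +
      (St.filter fun ik => (univ.filter fun b => (p ik.1).2 b ≠ (p ik.2).2 b).card = 2).card +
      ∑ ik ∈ St, (univ.filter fun b => (p ik.1).2 b ≠ (p ik.2).2 b).card := by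
    have hTS : (St.filter fun ik => (univ.filter fun b => (p ik.1).2 b ≠ (p ik.2).2 b).card = 1).card =
        ∑ ik ∈ St, if (univ.filter fun b => (p ik.1).2 b ≠ (p ik.2).2 b).card = 1 then 1 else 0 :=
      Finset.card_filter _ _
    have hDS : (St.filter fun ik => (univ.filter fun b => (p ik.1).2 b ≠ (p ik.2).2 b).card = 2).card =
        ∑ ik ∈ St, if (univ.filter fun b => (p ik.1).2 b ≠ (p ik.2).2 b).card = 2 then 1 else 0 :=
      Finset.card_filter _ _
    have h3S : 3 * St.card = ∑ _ik ∈ St, 3 := by rw [Finset.sum_const, smul_eq_mul, mul_comm]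
    rw [hTS, hDS, h3S, Finset.mul_sum, ← Finset.sum_add_distrib, ← Finset.sum_add_distrib]
    refine Finset.sum_le_sum fun ik hik => ?_
    have := h4 ik hik
    split_ifs <;> omega
  -- (6) change mass, (7) tight steps
  have h6 := sum_card_chg_le d v ε θ p hθ hdom St (fun ik hik => (hStmem ik).1 hik)
  have h7 := card_tight_le d v ε θ p hθ hdom
    (St.filter fun ik => (univ.filter fun b => (p ik.1).2 b ≠ (p ik.2).2 b).card = 1)
    (fun ik hik => by
      obtain ⟨h, hc⟩ := Finset.mem_filter.mp hik
      obtain ⟨ha, hb, hc'⟩ := (hStmem ik).1 h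
      exact ⟨ha, hb, hc', hc⟩)
  calc 3 * (n + 1) ≤ 3 * NP.card + 3 * St.card := by omega
    _ ≤ 3 * (univ.image fun k => (p k).1).card +
        (2 * (m ^ 2 * (K - 1)) +
          (St.filter fun ik => (univ.filter fun b => (p ik.1).2 b ≠ (p ik.2).2 b).card = 2).card +
          (K - 1) * ((univ.image fun k => (p k).1).card * m)) := by omega
    _ = (3 + m * (K - 1)) * (univ.image fun k => (p k).1).card + 2 * (m ^ 2 * (K - 1)) +
        (St.filter fun ik => (univ.filter fun b => (p ik.1).2 b ≠ (p ik.2).2 b).card = 2).card := by ring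

/-- **The `m = 3` row: twelve per class level plus a third of the double steps.**  For a dominant chain of a design of format `(3, K)` with
consecutive terms distinct and `D` double steps: `3(n+1) ≤ 18 + 36(K−1) + D`, i.e. `n + 1 ≤ 6 + 12(K−1) + D/3`. [this cell] -/
theorem three_row_twelve_add_doubles {K n : ℕ} (d : Fin K → ℕ) (v ε : Fin 3 → Fin 3 → Fin K → ℤ) (θ : Fin (n + 1) → ℤ)
    (p : Fin (n + 1) → Equiv.Perm (Fin 3) × (Fin 3 → Fin K))
    (hθ : StrictMono θ) (hdom : ∀ k, IsDominant d v ε (θ k) (p k)) (hsucc : ∀ k : Fin n, p k.castSucc ≠ p k.succ) :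
    3 * (n + 1) ≤ 18 + 36 * (K - 1) +
      ((univ : Finset (Fin (n + 1) × Fin (n + 1))).filter fun ik =>
        (ik.1 < ik.2 ∧ (p ik.1).1 = (p ik.2).1 ∧ ∀ j, ik.1 < j → j < ik.2 → (p j).1 ≠ (p ik.2).1) ∧
        (univ.filter fun b => (p ik.1).2 b ≠ (p ik.2).2 b).card = 2).card := by
  classical
  have h := three_mul_succ_le_of_succ_ne d v ε θ p hθ hdom hsucc
  have hPi : (univ.image fun k => (p k).1).card ≤ 6 := by
    calc (univ.image fun k => (p k).1).card ≤ Fintype.card (Equiv.Perm (Fin 3)) := Finset.card_le_univ _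
      _ = 6 := by rw [Fintype.card_perm, Fintype.card_fin]; rfl
  have hstep : (3 + 3 * (K - 1)) * (univ.image fun k => (p k).1).card ≤ (3 + 3 * (K - 1)) * 6 :=
    Nat.mul_le_mul_left _ hPi
  nlinarith [hstep, h]

end Chain

end RefreshExclusivity

end Summit.ValiantsHypothesis.ValiantsHypothesis.Theorems.KPlusLogSqLaw
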